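import Summits.Ventures.HodgeRepro2.GaloisSextic

/-!
# Reflex.lean — the reflex field of a CM type of a Galois CM field (Shimura 1998, §8.2–8.4)

Seat p1 (gen 2) of the blind cell pub-hodge-repro2.  Printed source (G. Shimura, *Abelian varieties
with complex multiplication and modular functions*, Princeton Math. Ser. 46, 1998; transcribed by
lit-1 in SOURCES.md S13.4, S13.5, S13.7, chunk locators there), in the Galois case `L = F`,
`H₁ = {1}` of §8.4 Example (1):

* §8.2 Proposition 26: with `H′ = {γ ∈ G | γS = S}`, "`(F; {φ_i})` is primitive if and only if
  `H₁ = H′`" — for `F` Galois over `ℚ`: primitive ⟺ `H′ = {1}`  (`isPrimitiveOn_iff_typeStabilizer_eq_bot`);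
* §8.3 Proposition 28: "`S* = {σ⁻¹ | σ ∈ S}`, `H* = {γ | γ ∈ G, γS* = S*}`.  Let `K*` be the
  subfield of `L` corresponding to `H*`" — `reflexStabilizer` and `reflexFieldOf` below (the reflex
  field is the fixed field of the left stabiliser of the inverse type);
* §8.4 Example (1): "if `F` is abelian over `ℚ`, the subgroup `H*` defined in Proposition 28
  coincides with the subgroup `H′ = {γ ∈ G | γS = S}`.  If moreover `(F; {φ_i})` is primitive, `H′`
  must be the identity-subgroup, so that the field corresponding to `H*` is `F`" —
  `typeStabilizer_inv_eq_of_comm` and `reflexFieldOf_eq_top_of_isPrimitiveOn`.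

Added for TIER3 §5(i) ("the 2 non-primitive types … with reflex field `𝐅₁`", the imaginary quadratic
subfield): for a Galois CM field of degree 6, a NON-primitive CM type has reflex field of degree 2
over `ℚ` (`finrank_reflexFieldOf_eq_two_of_not_isPrimitiveOn`): its stabiliser is a non-trivial
subgroup of the cyclic group of order 6 not containing complex conjugation, hence of order 3.

`IsPrimitiveOn` is the group-theoretic stabiliser condition (Proposition 26's criterion), not
Shimura's definition "the abelian varieties of that type are simple" (§8.2); the equivalence of the
two is Proposition 26 and is not formalised.
-/

namespace Summit.Ventures.HodgeRepro2

open NumberField Pointwise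

/-! ## A. The stabiliser `H′ = {γ | γS = S}` on an abstract group -/

section Stabilizer

variable {G : Type*} [Group G]

/-- `H′ = {γ ∈ G | γS = S}` (Shimura 1998 Prop. 26): the stabiliser of `S ⊆ G` under left
translation. -/
def typeStabilizer (S : Set G) : Subgroup G := MulAction.stabilizer G S

/-- `γ ∈ H′ ↔ γS = S`. -/
theorem mem_typeStabilizer_iff (S : Set G) (g : G) : g ∈ typeStabilizer S ↔ g • S = S :=
  MulAction.mem_stabilizer_iff

/-- `γ ∈ H′ ↔ (∀ x, γx ∈ S ↔ x ∈ S)`. -/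
theorem mem_typeStabilizer_iff_forall (S : Set G) (g : G) :
    g ∈ typeStabilizer S ↔ ∀ x, g * x ∈ S ↔ x ∈ S := by
  rw [mem_typeStabilizer_iff]
  constructor
  · intro hg x
    constructor
    · intro hx
      have : g * x ∈ g • S := by rw [hg]; exact hx
      rwa [Set.mem_smul_set_iff_inv_smul_mem, smul_eq_mul, inv_mul_cancel_left] at this
    · intro hx
      have := Set.smul_mem_smul_set (a := g) hx
      rwa [hg] at this
  · intro hg
    ext x
    rw [Set.mem_smul_set_iff_inv_smul_mem, smul_eq_mul]
    have := hg (g⁻¹ * x)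
    rw [mul_inv_cancel_left] at this
    exact this.symm

/-- **Proposition 26 in the Galois case** (`H₁ = {1}`): `S` is primitive iff `H′ = {1}`. -/
theorem isPrimitiveOn_iff_typeStabilizer_eq_bot (S : Set G) :
    IsPrimitiveOn S ↔ typeStabilizer S = ⊥ := by
  rw [Subgroup.eq_bot_iff_forall]
  constructor
  · intro h g hg
    exact h g ((mem_typeStabilizer_iff_forall S g).mp hg)
  · intro h g hg
    exact h g ((mem_typeStabilizer_iff_forall S g).mpr hg)

/-- For a commutative group, `γ S⁻¹ = (γ⁻¹ S)⁻¹`. -/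
theorem smul_inv_eq_of_comm (hcomm : ∀ a b : G, a * b = b * a) (g : G) (S : Set G) :
    g • S⁻¹ = (g⁻¹ • S)⁻¹ := by
  ext x
  rw [Set.mem_inv, Set.mem_smul_set_iff_inv_smul_mem, Set.mem_smul_set_iff_inv_smul_mem,
    smul_eq_mul, smul_eq_mul, Set.mem_inv, inv_inv, mul_inv_rev, inv_inv, hcomm]

/-- **§8.4 Example (1), first sentence**: for `G` commutative, `H* = {γ | γS* = S*}` coincides
with `H′ = {γ | γS = S}`. -/
theorem typeStabilizer_inv_eq_of_comm (hcomm : ∀ a b : G, a * b = b * a) (S : Set G) :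
    typeStabilizer S⁻¹ = typeStabilizer S := by
  ext g
  rw [mem_typeStabilizer_iff, mem_typeStabilizer_iff, smul_inv_eq_of_comm hcomm, inv_inj]
  constructor
  · intro h
    have := congrArg (fun T : Set G => g • T) h
    rw [eq_comm]
    simpa [smul_smul] using this
  · intro h
    have := congrArg (fun T : Set G => g⁻¹ • T) h
    rw [eq_comm]
    simpa [smul_smul] using this

/-- Complex conjugation never stabilises a CM type: `ρ S = ρ-conjugate of S`, disjoint from `S`. -/
theorem conj_not_mem_typeStabilizer {ρ : G} {S : Set G}
    (hS : IsCMTypeOn ρ S) : ρ ∉ typeStabilizer S := by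
  intro h
  rw [mem_typeStabilizer_iff_forall] at h
  rcases hS 1 with ⟨h1, h2⟩ | ⟨h1, h2⟩
  · exact h2 ((h 1).mpr h1)
  · exact h2 ((h 1).mp h1)

end Stabilizer

/-! ## B. The reflex field of a CM type of a Galois CM field -/

section ReflexFieldGalois

variable (K : Type*) [Field K] [NumberField K] [IsGalois ℚ K]

/-- `H*` of Proposition 28 for `F = K` Galois: the stabiliser of the inverse type
`S* = {σ⁻¹ | σ ∈ S}`, `S = {σ | τ₀ ∘ σ ∈ Φ}`. -/
def reflexStabilizer (τ₀ : K →+* ℂ) (Φ : Set (K →+* ℂ)) : Subgroup (K ≃ₐ[ℚ] K) :=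
  typeStabilizer ((galEmb K τ₀) ⁻¹' Φ)⁻¹

/-- `K*`, "the subfield of `L` corresponding to `H*`" (Proposition 28): the fixed field of
`reflexStabilizer`. -/
def reflexFieldOf (τ₀ : K →+* ℂ) (Φ : Set (K →+* ℂ)) : IntermediateField ℚ K :=
  IntermediateField.fixedField (reflexStabilizer K τ₀ Φ)

/-- For `K` abelian over `ℚ`, `H* = H′` (§8.4 Example (1)). -/
theorem reflexStabilizer_eq_of_comm [IsMulCommutative (K ≃ₐ[ℚ] K)] (τ₀ : K →+* ℂ)
    (Φ : Set (K →+* ℂ)) :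
    reflexStabilizer K τ₀ Φ = typeStabilizer ((galEmb K τ₀) ⁻¹' Φ) :=
  typeStabilizer_inv_eq_of_comm (fun a b => IsMulCommutative.is_comm.comm a b) _

/-- The degree of the reflex field is the index of `H*`: `[K : K*] = |H*|`
(Galois correspondence). -/
theorem finrank_reflexFieldOf (τ₀ : K →+* ℂ) (Φ : Set (K →+* ℂ)) :
    Module.finrank (reflexFieldOf K τ₀ Φ) K = Nat.card (reflexStabilizer K τ₀ Φ) :=
  IntermediateField.finrank_fixedField_eq_card _

/-- **§8.4 Example (1)**: "if `F` is abelian over `ℚ` and if `(F; {φ_i})` is primitive, the reflex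
of `(F; {φ_i})` is `(F; {φ_i⁻¹})`" — the reflex FIELD is `F` itself (the reflex type is
`inverseType τ₀ Φ`, Faces.lean). -/
theorem reflexFieldOf_eq_top_of_isPrimitiveOn [IsMulCommutative (K ≃ₐ[ℚ] K)] (τ₀ : K →+* ℂ)
    {Φ : Set (K →+* ℂ)} (hprim : IsPrimitiveOn ((galEmb K τ₀) ⁻¹' Φ)) :
    reflexFieldOf K τ₀ Φ = ⊤ := by
  unfold reflexFieldOf
  rw [reflexStabilizer_eq_of_comm, (isPrimitiveOn_iff_typeStabilizer_eq_bot _).mp hprim]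
  exact IntermediateField.fixedField_bot

end ReflexFieldGalois

section ReflexFieldCM

variable (K : Type*) [Field K] [NumberField K] [IsCMField K] [IsGalois ℚ K]

/-- In a cyclic group of order 6, complex conjugation is the only element of order 2. -/
theorem eq_galConj_of_orderOf_eq_two (h6 : Module.finrank ℚ K = 6) (x : K ≃ₐ[ℚ] K)
    (hx : orderOf x = 2) : x = galConj K := by
  haveI := isCyclic_gal_of_finrank_six K h6
  have hcard : Fintype.card (K ≃ₐ[ℚ] K) = 6 := by
    rw [← Nat.card_eq_fintype_card, IsGalois.card_aut_eq_finrank, h6]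
  have h2 : (2 : ℕ) ∣ Fintype.card (K ≃ₐ[ℚ] K) := by rw [hcard]; norm_num
  have hcount := IsCyclic.card_orderOf_eq_totient h2
  rw [Nat.totient_two, Finset.card_eq_one] at hcount
  obtain ⟨a, ha⟩ := hcount
  have hx' : x ∈ ({a} : Finset (K ≃ₐ[ℚ] K)) := by
    rw [← ha]; simp [hx]
  have hc' : galConj K ∈ ({a} : Finset (K ≃ₐ[ℚ] K)) := by
    rw [← ha]; simp [orderOf_galConj]
  rw [Finset.mem_singleton] at hx' hc'
  rw [hx', hc']

/-- A subgroup of `Gal(K/ℚ)` (cyclic of order 6) not containing complex conjugation has odd order,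
hence order `1` or `3`. -/
theorem card_eq_one_or_three_of_galConj_notMem (h6 : Module.finrank ℚ K = 6)
    (H : Subgroup (K ≃ₐ[ℚ] K)) (hH : galConj K ∉ H) : Nat.card H = 1 ∨ Nat.card H = 3 := by
  have hdvd : Nat.card H ∣ Nat.card (K ≃ₐ[ℚ] K) := Subgroup.card_subgroup_dvd_card H
  rw [IsGalois.card_aut_eq_finrank, h6] at hdvd
  have hodd : ¬ (2 : ℕ) ∣ Nat.card H := by
    intro h2
    obtain ⟨x, hx⟩ := exists_prime_orderOf_dvd_card' 2 h2
    rw [← Subgroup.orderOf_coe] at hx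
    have := eq_galConj_of_orderOf_eq_two K h6 (x : K ≃ₐ[ℚ] K) hx
    exact hH (this ▸ x.2)
  have hle : Nat.card H ≤ 6 := Nat.le_of_dvd (by norm_num) hdvd
  have hpos : 0 < Nat.card H := Nat.card_pos
  interval_cases h : Nat.card H <;> omega

/-- **TIER3 §5(i)**: for a Galois CM field of degree 6, a non-primitive CM type has a reflex field
of degree 2 over `ℚ` (the imaginary quadratic subfield): the stabiliser is non-trivial, does not
contain complex conjugation, so has order 3. -/
theorem finrank_reflexFieldOf_eq_two_of_not_isPrimitiveOn (h6 : Module.finrank ℚ K = 6)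
    (τ₀ : K →+* ℂ) {Φ : Set (K →+* ℂ)} (hΦ : IsCMType K Φ)
    (hnp : ¬ IsPrimitiveOn ((galEmb K τ₀) ⁻¹' Φ)) :
    Module.finrank ℚ (reflexFieldOf K τ₀ Φ) = 2 := by
  haveI := isMulCommutative_gal_of_finrank_six K h6
  have hS : IsCMTypeOn (galConj K) ((galEmb K τ₀) ⁻¹' Φ) :=
    (isCMType_iff_isCMTypeOn K τ₀ Φ).mp hΦ
  have hne : reflexStabilizer K τ₀ Φ ≠ ⊥ := by
    rw [reflexStabilizer_eq_of_comm]
    intro h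
    exact hnp ((isPrimitiveOn_iff_typeStabilizer_eq_bot _).mpr h)
  have hconj : galConj K ∉ reflexStabilizer K τ₀ Φ := by
    rw [reflexStabilizer_eq_of_comm]
    exact conj_not_mem_typeStabilizer hS
  have h3 : Nat.card (reflexStabilizer K τ₀ Φ) = 3 := by
    rcases card_eq_one_or_three_of_galConj_notMem K h6 _ hconj with h1 | h3
    · exact absurd (Subgroup.card_eq_one.mp h1) hne
    · exact h3
  have hmul := Module.finrank_mul_finrank ℚ (reflexFieldOf K τ₀ Φ) K
  rw [finrank_reflexFieldOf, h3, h6] at hmul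
  omega

end ReflexFieldCM

end Summit.Ventures.HodgeRepro2
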